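import Literature.NumberTheory.LFunctions.BCHCrossTermErrorSumsTotal
import HarnessLib

/-!
# The cross term of the BCH mean square: the weighted error sum, activation families and total

Topic `Literature/NumberTheory/LFunctions`. Everything in this file is PROVED (no definitions, no
named facts).

Continuation of `BCHCrossTermErrorSums.lean` / `BCHCrossTermErrorSumsTotal.lean`: the two
activation-endpoint families of the stationary-phase error of the cross term of the
Balasubramanian–Conrey–Heath-Brown mean square (named fact
`Literature.Barriers.RiemannHypothesis.BalasubramanianConreyHeathBrown1985_meanSquare`), and the total:

* `BCH.sum_weight_kernel_mu_le` — the family `T₁ = 2πμ² > T`: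
  `≤ B² N (1 + log N)(1 + log X)(8Λ_X √(T/2π) + 24√(T/2))`, `Λ_X = 13 + 3 log X + 3 log(XN + 2)`;
* `BCH.sum_weight_kernel_nu_le` — the family `T₁ = 2πν² > T`:
  `≤ 64 B² N √X (T/2π)^{1/4} (2√π + 2(2 + log X + log(XN + 2)))`;
* `BCH.weightedErrSum_le` — **the weighted stationary-phase error sum of the cross term** on `[T, T']`,
  `T ≤ T' ≤ 2T`, `X = ⌊√(T'/2π)⌋`, `|a_h| ≤ B`:
  `Σ_{h,k ≤ N} Σ_{μ,ν ≤ X} |a_h||a_k|(hk)^{-1/2}(μν)^{-1/2} crossErr ≤ 4400 B² N X + 32 (E_T + E_μ + E_ν + E_{T'})`,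
  which is `O(B² N (X + √T + √X T^{1/4}) log³ T) = o(T)` for `N = T^θ`, `θ < ½`, `B = N^{o(1)}`.

## References

* [Levinson1974] N. Levinson, Adv. Math. 13 (1974), §5.
* [Titchmarsh1986] E. C. Titchmarsh, *The Theory of the Riemann Zeta-Function*, 2nd ed. (1986), §9.22.
-/

noncomputable section

open Finset Real

namespace Literature.NumberTheory.LFunctions.BCH

/-! ### Numeric steps for the `μ`-family -/

/-- `T √(2π/T) / (2π) = √(T/2π)` for `T > 0`. [folklore] -/
theorem T_mul_sqrt_div_eq {T : ℝ} (hT : 0 < T) : T * Real.sqrt (2 * π / T) / (2 * π) = Real.sqrt (T / (2 * π)) := by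
  have hπ := Real.pi_pos
  have e1 : T * Real.sqrt (2 * π / T) = Real.sqrt (2 * π * T) := by
    rw [show T * Real.sqrt (2 * π / T) = Real.sqrt (T ^ 2) * Real.sqrt (2 * π / T) by
      rw [Real.sqrt_sq hT.le], ← Real.sqrt_mul (sq_nonneg T)]
    congr 1
    field_simp
  rw [e1, div_eq_iff (by positivity : (2 * π : ℝ) ≠ 0)]
  rw [show Real.sqrt (T / (2 * π)) * (2 * π) = Real.sqrt (T / (2 * π)) * Real.sqrt ((2 * π) ^ 2) by
    rw [Real.sqrt_sq (by positivity)], ← Real.sqrt_mul (by positivity)]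
  congr 1
  field_simp

/-- Third numeric step: for `T > 0`, `2πμ² > T`, `Λ ≥ 0`, `x > 0`:
`8T · Λ/(2π x μ²) ≤ 8Λ√(T/2π)/(x μ)`. [folklore] -/
theorem third_term_le {T Λ x : ℝ} (hT : 0 < T) (hΛ : 0 ≤ Λ) (hx : 0 < x) {μ : ℕ} (hμ : 0 < μ)
    (hact : T < 2 * π * (μ : ℝ) ^ 2) :
    8 * T * (Λ * (1 / (2 * π * x * (μ : ℝ) ^ 2))) ≤ 8 * Λ * Real.sqrt (T / (2 * π)) * (1 / (x * μ)) := by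
  have hμR : (0 : ℝ) < μ := by exact_mod_cast hμ
  have hπ := Real.pi_pos
  have hinv := inv_sq_le_of_act hT hμ hact
  have e1 : 8 * T * (Λ * (1 / (2 * π * x * (μ : ℝ) ^ 2))) = (8 * T * Λ / (2 * π * x)) * (1 / (μ : ℝ) ^ 2) := by
    field_simp
  have e2 : 8 * Λ * Real.sqrt (T / (2 * π)) * (1 / (x * μ)) =
      (8 * T * Λ / (2 * π * x)) * (Real.sqrt (2 * π / T) * (1 / μ)) := by
    rw [← T_mul_sqrt_div_eq hT]
    field_simp
  rw [e1, e2]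
  exact mul_le_mul_of_nonneg_left hinv (by positivity)

/-- `T/√(2T) = √(T/2)`. [folklore] -/
theorem T_div_sqrt_two_mul {T : ℝ} (hT : 0 < T) : T / Real.sqrt (2 * T) = Real.sqrt (T / 2) := by
  have hs : 0 < Real.sqrt (2 * T) := Real.sqrt_pos.2 (by linarith)
  rw [div_eq_iff hs.ne', ← Real.sqrt_mul (by positivity : (0 : ℝ) ≤ T / 2),
    show T / 2 * (2 * T) = T ^ 2 by ring, Real.sqrt_sq hT.le]

/-! ### (E_μ) the family `T₁ = 2πμ²` -/

/-- **The `ν`-sum of one triple for the `μ`-family.** [cite: Levinson1974, §5] -/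
theorem kernel_mu_triple_le (a : ℕ → ℂ) {N X : ℕ} {T B : ℝ} (hT : 0 < T) (hB0 : 0 ≤ B)
    {h k μ : ℕ} (hh : 0 < h) (hk : 0 < k) (hμ : 0 < μ) (hkN : k ≤ N) (hμX : μ ≤ X)
    (hah : ‖a h‖ ≤ B) (hak : ‖a k‖ ≤ B) :
    ∑ ν ∈ Finset.Icc 1 X, ‖a h‖ * ‖a k‖ * ((h : ℝ) * k) ^ (-(1 / 2 : ℝ)) * ((μ : ℝ) * ν) ^ (-(1 / 2 : ℝ)) *
        (if T < 2 * π * (μ : ℝ) ^ 2 ∧ ν ≤ μ then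
          8 * T / (|crossFreq h k μ ν - 2 * π * (μ : ℝ) ^ 2| + Real.sqrt (2 * T)) else 0) ≤
      B ^ 2 * ((8 * (13 + 3 * Real.log X + 3 * Real.log ((X : ℝ) * N + 2)) * Real.sqrt (T / (2 * π))) *
          (1 / ((h : ℝ) * μ)) + (24 * Real.sqrt (T / 2)) * (1 / ((k : ℝ) * μ))) := by
  have hs : 0 < Real.sqrt (2 * T) := Real.sqrt_pos.2 (by linarith)
  have hhR : (0 : ℝ) < h := by exact_mod_cast hh
  have hkR : (0 : ℝ) < k := by exact_mod_cast hk
  have hμR : (0 : ℝ) < μ := by exact_mod_cast hμ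
  set Λ : ℝ := 13 + 3 * Real.log X + 3 * Real.log ((X : ℝ) * N + 2) with hΛ
  have hlogX : 0 ≤ Real.log (X : ℝ) := Real.log_natCast_nonneg X
  have hΛ0 : 0 ≤ Λ := by
    rw [hΛ]
    have : 0 ≤ Real.log ((X : ℝ) * N + 2) := Real.log_nonneg (by nlinarith [(by positivity : (0:ℝ) ≤ (X:ℝ) * N)])
    positivity
  have hR0 : 0 ≤ B ^ 2 * ((8 * Λ * Real.sqrt (T / (2 * π))) * (1 / ((h : ℝ) * μ)) +
      (24 * Real.sqrt (T / 2)) * (1 / ((k : ℝ) * μ))) := by positivity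
  by_cases hact : T < 2 * π * (μ : ℝ) ^ 2
  swap
  · -- the family is empty
    refine le_trans (le_of_eq (Finset.sum_eq_zero fun ν _ => ?_)) hR0
    rw [if_neg (fun h' => hact h'.1), mul_zero]
  set D : ℝ := 2 * π * (μ : ℝ) ^ 2 with hD
  have hD0 : 0 < D := by positivity
  set κ : ℝ := 2 * π * (μ : ℝ) * h / k with hκ
  have hκ0 : 0 < κ := slope_pos hh hk hμ
  -- drop `ν ≤ μ` and factor
  have hpt : ∀ ν ∈ Finset.Icc 1 X,
      ‖a h‖ * ‖a k‖ * ((h : ℝ) * k) ^ (-(1 / 2 : ℝ)) * ((μ : ℝ) * ν) ^ (-(1 / 2 : ℝ)) *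
        (if T < D ∧ ν ≤ μ then 8 * T / (|crossFreq h k μ ν - D| + Real.sqrt (2 * T)) else 0) ≤
      (‖a h‖ * ‖a k‖ * (((h : ℝ) * k) ^ (-(1 / 2 : ℝ)) * (μ : ℝ) ^ (-(1 / 2 : ℝ))) * (8 * T)) *
        ((ν : ℝ) ^ (-(1 / 2 : ℝ)) / (|κ * ν - D| + Real.sqrt (2 * T))) := by
    intro ν _
    have hW : 0 ≤ ‖a h‖ * ‖a k‖ * ((h : ℝ) * k) ^ (-(1 / 2 : ℝ)) * ((μ : ℝ) * ν) ^ (-(1 / 2 : ℝ)) := by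
      positivity
    have e : ‖a h‖ * ‖a k‖ * ((h : ℝ) * k) ^ (-(1 / 2 : ℝ)) * ((μ : ℝ) * ν) ^ (-(1 / 2 : ℝ)) *
        (8 * T / (|crossFreq h k μ ν - D| + Real.sqrt (2 * T))) =
      (‖a h‖ * ‖a k‖ * (((h : ℝ) * k) ^ (-(1 / 2 : ℝ)) * (μ : ℝ) ^ (-(1 / 2 : ℝ))) * (8 * T)) *
        ((ν : ℝ) ^ (-(1 / 2 : ℝ)) / (|κ * ν - D| + Real.sqrt (2 * T))) := by
      rw [rpow_mul_natCast μ ν, show crossFreq h k μ ν = κ * ν by rw [crossFreq_def, hκ]; ring]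
      ring
    split_ifs with hc
    · exact le_of_eq e
    · rw [mul_zero, ← e]
      exact mul_nonneg hW (by positivity)
  refine (Finset.sum_le_sum hpt).trans ?_
  rw [← Finset.mul_sum]
  have hinner := inner_tail_le hκ0 hD0 hs X
  have hw1 := weight_div_sqrt_slope_mul_sq hh hk hμ
  have hw2 := weight_mul_sqrt_slope hh hk hμ
  rw [← hκ] at hw1 hw2
  rw [← hD] at hw1
  -- `D/κ = μk/h ≤ XN`
  have hΛ' : 13 + 3 * Real.log X + 3 * Real.log (D / κ + 2) ≤ Λ := by
    rw [hΛ]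
    have hq : D / κ = (μ : ℝ) * k / h := by
      rw [hD, hκ]; field_simp
    have hle : D / κ + 2 ≤ (X : ℝ) * N + 2 := by
      rw [hq, div_add' _ _ _ hhR.ne', div_le_iff₀ hhR]
      have hμX' : (μ : ℝ) ≤ X := by exact_mod_cast hμX
      have hkN' : (k : ℝ) ≤ N := by exact_mod_cast hkN
      have h1 : (1 : ℝ) ≤ h := by exact_mod_cast hh
      nlinarith [mul_le_mul hμX' hkN' hkR.le (Nat.cast_nonneg X), (by positivity : (0:ℝ) ≤ (X:ℝ) * N)]
    have hpos : 0 < D / κ + 2 := by positivity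
    linarith [Real.log_le_log hpos hle]
  have hW0 : 0 ≤ ‖a h‖ * ‖a k‖ * (((h : ℝ) * k) ^ (-(1 / 2 : ℝ)) * (μ : ℝ) ^ (-(1 / 2 : ℝ))) * (8 * T) := by
    positivity
  have hwt0 : 0 ≤ ((h : ℝ) * k) ^ (-(1 / 2 : ℝ)) * (μ : ℝ) ^ (-(1 / 2 : ℝ)) := by positivity
  have hsD : Real.sqrt D = Real.sqrt (2 * π) * μ := by
    rw [hD, Real.sqrt_mul (by positivity), Real.sqrt_sq hμR.le]
  have h2π : 0 < Real.sqrt (2 * π) := Real.sqrt_pos.2 (by positivity)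
  have t3 := third_term_le (x := (h : ℝ)) hT hΛ0 hhR hμ hact
  have t4 : 8 * T * (3 / (Real.sqrt (2 * T) * (Real.sqrt (2 * π) * μ)) * (Real.sqrt (2 * π) / k)) =
      24 * Real.sqrt (T / 2) * (1 / ((k : ℝ) * μ)) := by
    rw [← T_div_sqrt_two_mul hT]
    field_simp
    norm_num
  have hab : ‖a h‖ * ‖a k‖ ≤ B * B := mul_le_mul hah hak (norm_nonneg _) hB0
  calc (‖a h‖ * ‖a k‖ * (((h : ℝ) * k) ^ (-(1 / 2 : ℝ)) * (μ : ℝ) ^ (-(1 / 2 : ℝ))) * (8 * T)) *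
        ∑ ν ∈ Finset.Icc 1 X, (ν : ℝ) ^ (-(1 / 2 : ℝ)) / (|κ * ν - D| + Real.sqrt (2 * T))
      ≤ (‖a h‖ * ‖a k‖ * (((h : ℝ) * k) ^ (-(1 / 2 : ℝ)) * (μ : ℝ) ^ (-(1 / 2 : ℝ))) * (8 * T)) *
        (Λ / Real.sqrt (κ * D) + 3 * Real.sqrt κ / (Real.sqrt (2 * T) * Real.sqrt D)) := by
        refine mul_le_mul_of_nonneg_left (hinner.trans ?_) hW0
        gcongr
    _ = (‖a h‖ * ‖a k‖) * (8 * T * (Λ * (((h : ℝ) * k) ^ (-(1 / 2 : ℝ)) * (μ : ℝ) ^ (-(1 / 2 : ℝ)) /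
            Real.sqrt (κ * D))) + 8 * T * (3 / (Real.sqrt (2 * T) * Real.sqrt D) *
            (((h : ℝ) * k) ^ (-(1 / 2 : ℝ)) * (μ : ℝ) ^ (-(1 / 2 : ℝ)) * Real.sqrt κ))) := by ring
    _ = (‖a h‖ * ‖a k‖) * (8 * T * (Λ * (1 / (2 * π * h * (μ : ℝ) ^ 2))) +
          8 * T * (3 / (Real.sqrt (2 * T) * (Real.sqrt (2 * π) * μ)) * (Real.sqrt (2 * π) / k))) := by
        rw [hw1, hw2, hsD]
    _ ≤ (B * B) * ((8 * Λ * Real.sqrt (T / (2 * π))) * (1 / ((h : ℝ) * μ)) +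
          (24 * Real.sqrt (T / 2)) * (1 / ((k : ℝ) * μ))) := by
        have h0 : 0 ≤ 8 * T * (Λ * (1 / (2 * π * h * (μ : ℝ) ^ 2))) +
            8 * T * (3 / (Real.sqrt (2 * T) * (Real.sqrt (2 * π) * μ)) * (Real.sqrt (2 * π) / k)) := by
          positivity
        refine mul_le_mul hab ?_ h0 (by positivity)
        rw [t4]
        linarith
    _ = _ := by ring

/-- **(E_μ)** the family `T₁ = 2πμ²`:
`Σ_q |a_h||a_k|(hk)^{-1/2}(μν)^{-1/2} [T < 2πμ², ν ≤ μ] 8T/(|c − 2πμ²| + √(2T))`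
`  ≤ B² N (1 + log N)(1 + log X)(8Λ_X√(T/2π) + 24√(T/2))`, `Λ_X = 13 + 3 log X + 3 log(XN + 2)`.
[cite: Levinson1974, §5] -/
theorem sum_weight_kernel_mu_le (a : ℕ → ℂ) (N X : ℕ) {T B : ℝ} (hT : 0 < T)
    (hB : ∀ h ∈ Finset.Icc 1 N, ‖a h‖ ≤ B) :
    ∑ h ∈ Finset.Icc 1 N, ∑ k ∈ Finset.Icc 1 N, ∑ μ ∈ Finset.Icc 1 X, ∑ ν ∈ Finset.Icc 1 X,
      ‖a h‖ * ‖a k‖ * ((h : ℝ) * k) ^ (-(1 / 2 : ℝ)) * ((μ : ℝ) * ν) ^ (-(1 / 2 : ℝ)) *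
        (if T < 2 * π * (μ : ℝ) ^ 2 ∧ ν ≤ μ then
          8 * T / (|crossFreq h k μ ν - 2 * π * (μ : ℝ) ^ 2| + Real.sqrt (2 * T)) else 0) ≤
      B ^ 2 * N * (1 + Real.log N) * (1 + Real.log X) *
        (8 * (13 + 3 * Real.log X + 3 * Real.log ((X : ℝ) * N + 2)) * Real.sqrt (T / (2 * π)) +
          24 * Real.sqrt (T / 2)) := by
  rcases Nat.eq_zero_or_pos N with rfl | hN
  · simp
  have hB0 : 0 ≤ B := le_trans (norm_nonneg _) (hB 1 (Finset.mem_Icc.2 ⟨le_rfl, hN⟩))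
  set c₃ : ℝ := 8 * (13 + 3 * Real.log X + 3 * Real.log ((X : ℝ) * N + 2)) * Real.sqrt (T / (2 * π)) with hc₃
  set c₄ : ℝ := 24 * Real.sqrt (T / 2) with hc₄
  have hlogX : 0 ≤ Real.log (X : ℝ) := Real.log_natCast_nonneg X
  have hc₃0 : 0 ≤ c₃ := by
    rw [hc₃]
    have : 0 ≤ Real.log ((X : ℝ) * N + 2) := Real.log_nonneg (by nlinarith [(by positivity : (0:ℝ) ≤ (X:ℝ) * N)])
    positivity
  have hc₄0 : 0 ≤ c₄ := by rw [hc₄]; positivity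
  have hper : ∀ h ∈ Finset.Icc 1 N, ∀ k ∈ Finset.Icc 1 N, ∀ μ ∈ Finset.Icc 1 X,
      ∑ ν ∈ Finset.Icc 1 X, ‖a h‖ * ‖a k‖ * ((h : ℝ) * k) ^ (-(1 / 2 : ℝ)) * ((μ : ℝ) * ν) ^ (-(1 / 2 : ℝ)) *
        (if T < 2 * π * (μ : ℝ) ^ 2 ∧ ν ≤ μ then
          8 * T / (|crossFreq h k μ ν - 2 * π * (μ : ℝ) ^ 2| + Real.sqrt (2 * T)) else 0) ≤
        B ^ 2 * (c₃ * (1 / ((h : ℝ) * μ)) + c₄ * (1 / ((k : ℝ) * μ))) :=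
    fun h hh k hk μ hμ => kernel_mu_triple_le a hT hB0 (Finset.mem_Icc.1 hh).1 (Finset.mem_Icc.1 hk).1
      (Finset.mem_Icc.1 hμ).1 (Finset.mem_Icc.1 hk).2 (Finset.mem_Icc.1 hμ).2 (hB h hh) (hB k hk)
  have hHN : ∑ h ∈ Finset.Icc 1 N, 1 / (h : ℝ) ≤ 1 + Real.log N := sum_one_div_le_log N
  have hHX : ∑ μ ∈ Finset.Icc 1 X, 1 / (μ : ℝ) ≤ 1 + Real.log X := sum_one_div_le_log X
  have hHN0 : 0 ≤ ∑ h ∈ Finset.Icc 1 N, 1 / (h : ℝ) := Finset.sum_nonneg fun h _ => by positivity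
  have hHX0 : 0 ≤ ∑ μ ∈ Finset.Icc 1 X, 1 / (μ : ℝ) := Finset.sum_nonneg fun μ _ => by positivity
  have hsum : ∑ h ∈ Finset.Icc 1 N, ∑ k ∈ Finset.Icc 1 N, ∑ μ ∈ Finset.Icc 1 X,
      B ^ 2 * (c₃ * (1 / ((h : ℝ) * μ)) + c₄ * (1 / ((k : ℝ) * μ))) =
      B ^ 2 * (c₃ * ((∑ h ∈ Finset.Icc 1 N, 1 / (h : ℝ)) * N * ∑ μ ∈ Finset.Icc 1 X, 1 / (μ : ℝ)) +
        c₄ * (N * (∑ k ∈ Finset.Icc 1 N, 1 / (k : ℝ)) * ∑ μ ∈ Finset.Icc 1 X, 1 / (μ : ℝ))) := by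
    have e1 : ∀ h k μ : ℕ, B ^ 2 * (c₃ * (1 / ((h : ℝ) * μ)) + c₄ * (1 / ((k : ℝ) * μ))) =
        B ^ 2 * c₃ * ((1 / (h : ℝ)) * (1 / (μ : ℝ))) + B ^ 2 * c₄ * ((1 / (k : ℝ)) * (1 / (μ : ℝ))) := by
      intro h k μ
      rw [one_div_mul_one_div, one_div_mul_one_div]
      ring
    simp_rw [e1, Finset.sum_add_distrib, ← Finset.mul_sum, Finset.sum_const, nsmul_eq_mul, Nat.card_Icc,
      Nat.add_sub_cancel]
    rw [← Finset.sum_mul, ← Finset.sum_mul]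
    ring
  calc ∑ h ∈ Finset.Icc 1 N, ∑ k ∈ Finset.Icc 1 N, ∑ μ ∈ Finset.Icc 1 X, ∑ ν ∈ Finset.Icc 1 X,
        ‖a h‖ * ‖a k‖ * ((h : ℝ) * k) ^ (-(1 / 2 : ℝ)) * ((μ : ℝ) * ν) ^ (-(1 / 2 : ℝ)) *
          (if T < 2 * π * (μ : ℝ) ^ 2 ∧ ν ≤ μ then
            8 * T / (|crossFreq h k μ ν - 2 * π * (μ : ℝ) ^ 2| + Real.sqrt (2 * T)) else 0)
      ≤ ∑ h ∈ Finset.Icc 1 N, ∑ k ∈ Finset.Icc 1 N, ∑ μ ∈ Finset.Icc 1 X,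
          B ^ 2 * (c₃ * (1 / ((h : ℝ) * μ)) + c₄ * (1 / ((k : ℝ) * μ))) :=
        Finset.sum_le_sum fun h hh => Finset.sum_le_sum fun k hk => Finset.sum_le_sum fun μ hμ =>
          hper h hh k hk μ hμ
    _ = _ := hsum
    _ ≤ B ^ 2 * (c₃ * ((1 + Real.log N) * N * (1 + Real.log X)) +
          c₄ * (N * (1 + Real.log N) * (1 + Real.log X))) := by gcongr
    _ = _ := by rw [hc₃, hc₄]; ring

/-! ### Numeric steps for the `ν`-family -/

/-- `√(2T) = 2√π · √(T/2π)`. [folklore] -/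
theorem sqrt_two_mul_eq {T : ℝ} (hT : 0 < T) :
    Real.sqrt (2 * T) = 2 * Real.sqrt π * Real.sqrt (T / (2 * π)) := by
  have hπ := Real.pi_pos
  rw [← Real.sqrt_mul_self (by positivity : (0:ℝ) ≤ 2 * Real.sqrt π), ← Real.sqrt_mul (by positivity)]
  congr 1
  have : Real.sqrt π * Real.sqrt π = π := Real.mul_self_sqrt hπ.le
  field_simp
  nlinarith [this]

/-- `2/(√(2T)/(2π v₀)) = 2√π`, `v₀ = √(T/2π)`. [folklore] -/
theorem act_scale_a {T : ℝ} (hT : 0 < T) :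
    2 / (Real.sqrt (2 * T) / (2 * π * Real.sqrt (T / (2 * π)))) = 2 * Real.sqrt π := by
  have hπ := Real.pi_pos
  have hv : 0 < Real.sqrt (T / (2 * π)) := Real.sqrt_pos.2 (by positivity)
  have hsπ : 0 < Real.sqrt π := Real.sqrt_pos.2 hπ
  have hππ : Real.sqrt π * Real.sqrt π = π := Real.mul_self_sqrt hπ.le
  rw [sqrt_two_mul_eq hT]
  field_simp
  nlinarith [hππ]

/-- `T · (1/√v₀) · (1/(2π v₀)) = √v₀`, `v₀ = √(T/2π)`. [folklore] -/
theorem act_scale_b {T : ℝ} (hT : 0 < T) :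
    T * (1 / Real.sqrt (Real.sqrt (T / (2 * π)))) * (1 / (2 * π * Real.sqrt (T / (2 * π)))) =
      Real.sqrt (Real.sqrt (T / (2 * π))) := by
  have hπ := Real.pi_pos
  set r := Real.sqrt (T / (2 * π)) with hr
  have hr0 : 0 < r := Real.sqrt_pos.2 (by positivity)
  set q := Real.sqrt r with hq
  have hq0 : 0 < q := Real.sqrt_pos.2 hr0
  have hrr : r * r = T / (2 * π) := Real.mul_self_sqrt (by positivity)
  have hqq : q * q = r := Real.mul_self_sqrt hr0.le
  have hT' : T = 2 * π * (r * r) := by rw [hrr]; field_simp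
  rw [hT']
  field_simp
  nlinarith [hqq, hq0, hr0]

/-! ### (E_ν) the family `T₁ = 2πν²` -/

/-- **The `ν`-sum of one triple for the `ν`-family.** [cite: Levinson1974, §5] -/
theorem kernel_nu_triple_le (a : ℕ → ℂ) {N X : ℕ} {T : ℝ} (hT : 0 < T)
    {h k μ : ℕ} (hh : 0 < h) (hk : 0 < k) (hμ : 0 < μ) (hhN : h ≤ N) (hμX : μ ≤ X) :
    ∑ ν ∈ Finset.Icc 1 X, ‖a h‖ * ‖a k‖ * ((h : ℝ) * k) ^ (-(1 / 2 : ℝ)) * ((μ : ℝ) * ν) ^ (-(1 / 2 : ℝ)) *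
        (if T < 2 * π * (ν : ℝ) ^ 2 ∧ μ ≤ ν then
          8 * T / (|crossFreq h k μ ν - 2 * π * (ν : ℝ) ^ 2| + Real.sqrt (2 * T)) else 0) ≤
      (‖a h‖ * (1 / Real.sqrt h)) * (‖a k‖ * (1 / Real.sqrt k)) * (1 / Real.sqrt μ) *
        (8 * T * ((1 / Real.sqrt (Real.sqrt (T / (2 * π)))) * (1 / (2 * π * Real.sqrt (T / (2 * π)))) *
          (2 / (Real.sqrt (2 * T) / (2 * π * Real.sqrt (T / (2 * π)))) +
            2 * (2 + Real.log X + Real.log ((X : ℝ) * N + 2))))) := by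
  have hs : 0 < Real.sqrt (2 * T) := Real.sqrt_pos.2 (by linarith)
  have hhR : (0 : ℝ) < h := by exact_mod_cast hh
  have hkR : (0 : ℝ) < k := by exact_mod_cast hk
  have hμR : (0 : ℝ) < μ := by exact_mod_cast hμ
  set ν₂ : ℝ := (μ : ℝ) * h / k with hν₂
  have hν₂0 : 0 ≤ ν₂ := by positivity
  set W₃ : ℝ := ‖a h‖ * ‖a k‖ * (((h : ℝ) * k) ^ (-(1 / 2 : ℝ)) * (μ : ℝ) ^ (-(1 / 2 : ℝ))) * (8 * T) with hW₃
  have hW₃0 : 0 ≤ W₃ := by positivity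
  -- pointwise: drop `μ ≤ ν`, rewrite `|c − 2πν²| = 2πν|ν − ν₂|`
  have hpt : ∀ ν ∈ Finset.Icc 1 X,
      ‖a h‖ * ‖a k‖ * ((h : ℝ) * k) ^ (-(1 / 2 : ℝ)) * ((μ : ℝ) * ν) ^ (-(1 / 2 : ℝ)) *
        (if T < 2 * π * (ν : ℝ) ^ 2 ∧ μ ≤ ν then
          8 * T / (|crossFreq h k μ ν - 2 * π * (ν : ℝ) ^ 2| + Real.sqrt (2 * T)) else 0) ≤
      W₃ * (if T < 2 * π * (ν : ℝ) ^ 2 then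
        (ν : ℝ) ^ (-(1 / 2 : ℝ)) / (2 * π * ν * |(ν : ℝ) - ν₂| + Real.sqrt (2 * T)) else 0) := by
    intro ν hν
    have hν0 : (0 : ℝ) < ν := by exact_mod_cast (Finset.mem_Icc.1 hν).1
    have habs : |crossFreq h k μ ν - 2 * π * (ν : ℝ) ^ 2| = 2 * π * ν * |(ν : ℝ) - ν₂| := by
      rw [crossFreq_def, show 2 * π * (μ : ℝ) * ν * h / k - 2 * π * (ν : ℝ) ^ 2 =
        (2 * π * ν) * (ν₂ - ν) by rw [hν₂]; field_simp, abs_mul, abs_of_pos (by positivity),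
        abs_sub_comm]
    have e : ‖a h‖ * ‖a k‖ * ((h : ℝ) * k) ^ (-(1 / 2 : ℝ)) * ((μ : ℝ) * ν) ^ (-(1 / 2 : ℝ)) *
        (8 * T / (|crossFreq h k μ ν - 2 * π * (ν : ℝ) ^ 2| + Real.sqrt (2 * T))) =
      W₃ * ((ν : ℝ) ^ (-(1 / 2 : ℝ)) / (2 * π * ν * |(ν : ℝ) - ν₂| + Real.sqrt (2 * T))) := by
      rw [habs, rpow_mul_natCast μ ν, hW₃]
      ring
    by_cases hc : T < 2 * π * (ν : ℝ) ^ 2 ∧ μ ≤ ν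
    · rw [if_pos hc, if_pos hc.1, e]
    · rw [if_neg hc, mul_zero]
      split_ifs
      · exact mul_nonneg hW₃0 (by positivity)
      · rw [mul_zero]
  refine (Finset.sum_le_sum hpt).trans ?_
  rw [← Finset.mul_sum]
  have hinner := inner_tail_nu_le hT hs ν₂ X
  have hlog : Real.log (|ν₂| + 2) ≤ Real.log ((X : ℝ) * N + 2) := by
    rw [abs_of_nonneg hν₂0]
    apply Real.log_le_log (by positivity)
    have hμX' : (μ : ℝ) ≤ X := by exact_mod_cast hμX
    have hhN' : (h : ℝ) ≤ N := by exact_mod_cast hhN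
    have hk1 : (1 : ℝ) ≤ k := by exact_mod_cast hk
    have : ν₂ ≤ (X : ℝ) * N := by
      rw [hν₂, div_le_iff₀ hkR]
      nlinarith [mul_le_mul hμX' hhN' hhR.le (Nat.cast_nonneg X), (by positivity : (0:ℝ) ≤ (X : ℝ) * N)]
    linarith
  have hv : 0 < Real.sqrt (T / (2 * π)) := Real.sqrt_pos.2 (by positivity)
  have hW₃eq : W₃ = (‖a h‖ * (1 / Real.sqrt h)) * (‖a k‖ * (1 / Real.sqrt k)) * (1 / Real.sqrt μ) * (8 * T) := by
    rw [hW₃, weight_eq]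
    ring
  calc W₃ * ∑ ν ∈ Finset.Icc 1 X, (if T < 2 * π * (ν : ℝ) ^ 2 then
        (ν : ℝ) ^ (-(1 / 2 : ℝ)) / (2 * π * ν * |(ν : ℝ) - ν₂| + Real.sqrt (2 * T)) else 0)
      ≤ W₃ * ((1 / Real.sqrt (Real.sqrt (T / (2 * π)))) * (1 / (2 * π * Real.sqrt (T / (2 * π)))) *
        (2 / (Real.sqrt (2 * T) / (2 * π * Real.sqrt (T / (2 * π)))) +
          2 * (2 + Real.log X + Real.log (|ν₂| + 2)))) := mul_le_mul_of_nonneg_left hinner hW₃0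
    _ ≤ W₃ * ((1 / Real.sqrt (Real.sqrt (T / (2 * π)))) * (1 / (2 * π * Real.sqrt (T / (2 * π)))) *
        (2 / (Real.sqrt (2 * T) / (2 * π * Real.sqrt (T / (2 * π)))) +
          2 * (2 + Real.log X + Real.log ((X : ℝ) * N + 2)))) := by
        gcongr
    _ = _ := by rw [hW₃eq]; ring

/-- **(E_ν)** the family `T₁ = 2πν²`:
`Σ_q |a_h||a_k|(hk)^{-1/2}(μν)^{-1/2} [T < 2πν², μ ≤ ν] 8T/(|c − 2πν²| + √(2T))`
`  ≤ 64 B² N √X · (T/2π)^{1/4} (2√π + 2(2 + log X + log(XN + 2)))`. [cite: Levinson1974, §5] -/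
theorem sum_weight_kernel_nu_le (a : ℕ → ℂ) (N X : ℕ) {T B : ℝ} (hT : 0 < T)
    (hB : ∀ h ∈ Finset.Icc 1 N, ‖a h‖ ≤ B) :
    ∑ h ∈ Finset.Icc 1 N, ∑ k ∈ Finset.Icc 1 N, ∑ μ ∈ Finset.Icc 1 X, ∑ ν ∈ Finset.Icc 1 X,
      ‖a h‖ * ‖a k‖ * ((h : ℝ) * k) ^ (-(1 / 2 : ℝ)) * ((μ : ℝ) * ν) ^ (-(1 / 2 : ℝ)) *
        (if T < 2 * π * (ν : ℝ) ^ 2 ∧ μ ≤ ν then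
          8 * T / (|crossFreq h k μ ν - 2 * π * (ν : ℝ) ^ 2| + Real.sqrt (2 * T)) else 0) ≤
      64 * B ^ 2 * N * Real.sqrt X * (Real.sqrt (Real.sqrt (T / (2 * π))) *
        (2 * Real.sqrt π + 2 * (2 + Real.log X + Real.log ((X : ℝ) * N + 2)))) := by
  rcases Nat.eq_zero_or_pos N with rfl | hN
  · simp
  have hB0 : 0 ≤ B := le_trans (norm_nonneg _) (hB 1 (Finset.mem_Icc.2 ⟨le_rfl, hN⟩))
  have hπ := Real.pi_pos
  set Q : ℝ := 8 * T * ((1 / Real.sqrt (Real.sqrt (T / (2 * π)))) * (1 / (2 * π * Real.sqrt (T / (2 * π)))) *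
    (2 / (Real.sqrt (2 * T) / (2 * π * Real.sqrt (T / (2 * π)))) +
      2 * (2 + Real.log X + Real.log ((X : ℝ) * N + 2)))) with hQ
  have hlogX : 0 ≤ Real.log (X : ℝ) := Real.log_natCast_nonneg X
  have hlog2 : 0 ≤ Real.log ((X : ℝ) * N + 2) := Real.log_nonneg (by nlinarith [(by positivity : (0:ℝ) ≤ (X:ℝ) * N)])
  have hv : 0 < Real.sqrt (T / (2 * π)) := Real.sqrt_pos.2 (by positivity)
  have hs : 0 < Real.sqrt (2 * T) := Real.sqrt_pos.2 (by linarith)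
  have hQ0 : 0 ≤ Q := by rw [hQ]; positivity
  set f : ℕ → ℝ := fun h => ‖a h‖ * (1 / Real.sqrt h) with hf
  set g : ℕ → ℝ := fun μ => 1 / Real.sqrt μ with hg
  have hper : ∀ h ∈ Finset.Icc 1 N, ∀ k ∈ Finset.Icc 1 N, ∀ μ ∈ Finset.Icc 1 X,
      ∑ ν ∈ Finset.Icc 1 X, ‖a h‖ * ‖a k‖ * ((h : ℝ) * k) ^ (-(1 / 2 : ℝ)) * ((μ : ℝ) * ν) ^ (-(1 / 2 : ℝ)) *
        (if T < 2 * π * (ν : ℝ) ^ 2 ∧ μ ≤ ν then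
          8 * T / (|crossFreq h k μ ν - 2 * π * (ν : ℝ) ^ 2| + Real.sqrt (2 * T)) else 0) ≤
        f h * (f k * (g μ * Q)) := by
    intro h hh k hk μ hμ
    have := kernel_nu_triple_le a (N := N) hT (Finset.mem_Icc.1 hh).1 (Finset.mem_Icc.1 hk).1
      (Finset.mem_Icc.1 hμ).1 (Finset.mem_Icc.1 hh).2 (Finset.mem_Icc.1 hμ).2
    refine this.trans (le_of_eq ?_)
    rw [hf, hg, hQ]
    ring
  have hF : ∑ h ∈ Finset.Icc 1 N, f h ≤ B * (2 * Real.sqrt N) := sum_norm_div_sqrt_le a hB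
  have hG : ∑ μ ∈ Finset.Icc 1 X, g μ ≤ 2 * Real.sqrt X := sum_one_div_sqrt_le X
  have hF0 : 0 ≤ ∑ h ∈ Finset.Icc 1 N, f h := Finset.sum_nonneg fun h _ => by positivity
  have hG0 : 0 ≤ ∑ μ ∈ Finset.Icc 1 X, g μ := Finset.sum_nonneg fun μ _ => by positivity
  have hNN : Real.sqrt N ^ 2 = N := Real.sq_sqrt (Nat.cast_nonneg N)
  calc ∑ h ∈ Finset.Icc 1 N, ∑ k ∈ Finset.Icc 1 N, ∑ μ ∈ Finset.Icc 1 X, ∑ ν ∈ Finset.Icc 1 X,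
        ‖a h‖ * ‖a k‖ * ((h : ℝ) * k) ^ (-(1 / 2 : ℝ)) * ((μ : ℝ) * ν) ^ (-(1 / 2 : ℝ)) *
          (if T < 2 * π * (ν : ℝ) ^ 2 ∧ μ ≤ ν then
            8 * T / (|crossFreq h k μ ν - 2 * π * (ν : ℝ) ^ 2| + Real.sqrt (2 * T)) else 0)
      ≤ ∑ h ∈ Finset.Icc 1 N, ∑ k ∈ Finset.Icc 1 N, ∑ μ ∈ Finset.Icc 1 X, f h * (f k * (g μ * Q)) :=
        Finset.sum_le_sum fun h hh => Finset.sum_le_sum fun k hk => Finset.sum_le_sum fun μ hμ =>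
          hper h hh k hk μ hμ
    _ = (∑ h ∈ Finset.Icc 1 N, f h) * ((∑ k ∈ Finset.Icc 1 N, f k) * ((∑ μ ∈ Finset.Icc 1 X, g μ) * Q)) := by
        simp_rw [← Finset.mul_sum]
        rw [← Finset.sum_mul, ← Finset.sum_mul, ← Finset.sum_mul]
    _ ≤ (B * (2 * Real.sqrt N)) * ((B * (2 * Real.sqrt N)) * ((2 * Real.sqrt X) * Q)) := by gcongr
    _ = 8 * B ^ 2 * Real.sqrt N ^ 2 * Real.sqrt X * Q := by ring
    _ = 64 * B ^ 2 * N * Real.sqrt X * (Real.sqrt (Real.sqrt (T / (2 * π))) *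
        (2 * Real.sqrt π + 2 * (2 + Real.log X + Real.log ((X : ℝ) * N + 2)))) := by
        have hQ' : Q = 8 * Real.sqrt (Real.sqrt (T / (2 * π))) *
            (2 * Real.sqrt π + 2 * (2 + Real.log X + Real.log ((X : ℝ) * N + 2))) := by
          have hb := act_scale_b hT
          rw [hQ, act_scale_a hT]
          rw [show 8 * T * ((1 / Real.sqrt (Real.sqrt (T / (2 * π)))) * (1 / (2 * π * Real.sqrt (T / (2 * π)))) *
              (2 * Real.sqrt π + 2 * (2 + Real.log X + Real.log ((X : ℝ) * N + 2)))) =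
              8 * (T * (1 / Real.sqrt (Real.sqrt (T / (2 * π)))) * (1 / (2 * π * Real.sqrt (T / (2 * π))))) *
              (2 * Real.sqrt π + 2 * (2 + Real.log X + Real.log ((X : ℝ) * N + 2))) by ring, hb]
        rw [hNN, hQ']
        ring

/-! ### The total -/

/-- **The weighted stationary-phase error sum of the cross term.** For `0 < T ≤ T' ≤ 2T`, any `N, X`,
`|a_h| ≤ B` (`h ≤ N`):
`Σ_{h,k ≤ N} Σ_{μ,ν ≤ X} |a_h||a_k|(hk)^{-1/2}(μν)^{-1/2} crossErr(T,T',h,k,μ,ν)`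
`  ≤ 4400 B² N X + 32 (E_T + E_μ + E_ν + E_{T'})`
with the four family bounds of `sum_weight_kernel_le` (`D = T`, `D = T'`), `sum_weight_kernel_mu_le`,
`sum_weight_kernel_nu_le` — `O(B² N (X + √T + √X T^{1/4}) log³ T)`. [cite: Levinson1974, §5] -/
theorem weightedErrSum_le (a : ℕ → ℂ) (N X : ℕ) {T T' B : ℝ} (hT : 0 < T) (hTT' : T ≤ T')
    (hT'2 : T' ≤ 2 * T) (hB : ∀ h ∈ Finset.Icc 1 N, ‖a h‖ ≤ B) :
    ∑ h ∈ Finset.Icc 1 N, ∑ k ∈ Finset.Icc 1 N, ∑ μ ∈ Finset.Icc 1 X, ∑ ν ∈ Finset.Icc 1 X,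
      ‖a h‖ * ‖a k‖ * ((h : ℝ) * k) ^ (-(1 / 2 : ℝ)) * ((μ : ℝ) * ν) ^ (-(1 / 2 : ℝ)) *
        crossErr T T' h k μ ν ≤
      4400 * B ^ 2 * N * X + 32 * (
        B ^ 2 * N * (1 + Real.log N) *
          (8 * (13 + 3 * Real.log X + 3 * Real.log (T * N + 2)) * (1 + Real.log X) * Real.sqrt (T / (2 * π)) +
            24 * Real.sqrt π * X)
        + B ^ 2 * N * (1 + Real.log N) * (1 + Real.log X) *
          (8 * (13 + 3 * Real.log X + 3 * Real.log ((X : ℝ) * N + 2)) * Real.sqrt (T / (2 * π)) +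
            24 * Real.sqrt (T / 2))
        + 64 * B ^ 2 * N * Real.sqrt X * (Real.sqrt (Real.sqrt (T / (2 * π))) *
          (2 * Real.sqrt π + 2 * (2 + Real.log X + Real.log ((X : ℝ) * N + 2))))
        + B ^ 2 * N * (1 + Real.log N) *
          (8 * (13 + 3 * Real.log X + 3 * Real.log (T' * N + 2)) * (1 + Real.log X) * Real.sqrt (T / (2 * π)) +
            24 * Real.sqrt π * X)) := by
  -- pointwise kernel bound
  have hpt : ∀ h ∈ Finset.Icc 1 N, ∀ k ∈ Finset.Icc 1 N, ∀ μ ∈ Finset.Icc 1 X, ∀ ν ∈ Finset.Icc 1 X,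
      ‖a h‖ * ‖a k‖ * ((h : ℝ) * k) ^ (-(1 / 2 : ℝ)) * ((μ : ℝ) * ν) ^ (-(1 / 2 : ℝ)) * crossErr T T' h k μ ν ≤
      275 * (‖a h‖ * ‖a k‖ * ((h : ℝ) * k) ^ (-(1 / 2 : ℝ)) * ((μ : ℝ) * ν) ^ (-(1 / 2 : ℝ)))
      + 32 * (‖a h‖ * ‖a k‖ * ((h : ℝ) * k) ^ (-(1 / 2 : ℝ)) * ((μ : ℝ) * ν) ^ (-(1 / 2 : ℝ)) *
          (8 * T / (|crossFreq h k μ ν - T| + Real.sqrt (2 * T))))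
      + 32 * (‖a h‖ * ‖a k‖ * ((h : ℝ) * k) ^ (-(1 / 2 : ℝ)) * ((μ : ℝ) * ν) ^ (-(1 / 2 : ℝ)) *
          (if T < 2 * π * (μ : ℝ) ^ 2 ∧ ν ≤ μ then
            8 * T / (|crossFreq h k μ ν - 2 * π * (μ : ℝ) ^ 2| + Real.sqrt (2 * T)) else 0))
      + 32 * (‖a h‖ * ‖a k‖ * ((h : ℝ) * k) ^ (-(1 / 2 : ℝ)) * ((μ : ℝ) * ν) ^ (-(1 / 2 : ℝ)) *
          (if T < 2 * π * (ν : ℝ) ^ 2 ∧ μ ≤ ν then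
            8 * T / (|crossFreq h k μ ν - 2 * π * (ν : ℝ) ^ 2| + Real.sqrt (2 * T)) else 0))
      + 32 * (‖a h‖ * ‖a k‖ * ((h : ℝ) * k) ^ (-(1 / 2 : ℝ)) * ((μ : ℝ) * ν) ^ (-(1 / 2 : ℝ)) *
          (8 * T / (|crossFreq h k μ ν - T'| + Real.sqrt (2 * T)))) := by
    intro h _ k _ μ _ ν _
    have hW : 0 ≤ ‖a h‖ * ‖a k‖ * ((h : ℝ) * k) ^ (-(1 / 2 : ℝ)) * ((μ : ℝ) * ν) ^ (-(1 / 2 : ℝ)) := by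
      positivity
    have hker := crossErr_le_kernels hT hTT' hT'2 h k μ ν
    rw [abs_sub_comm T' (crossFreq h k μ ν)] at hker
    have := mul_le_mul_of_nonneg_left hker hW
    refine this.trans (le_of_eq ?_)
    ring
  have b0 := mul_le_mul_of_nonneg_left (sum_weight_le a N X hB) (by norm_num : (0 : ℝ) ≤ 275)
  have b1 := mul_le_mul_of_nonneg_left (sum_weight_kernel_le a N X hT le_rfl hB) (by norm_num : (0 : ℝ) ≤ 32)
  have b2 := mul_le_mul_of_nonneg_left (sum_weight_kernel_mu_le a N X hT hB) (by norm_num : (0 : ℝ) ≤ 32)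
  have b3 := mul_le_mul_of_nonneg_left (sum_weight_kernel_nu_le a N X hT hB) (by norm_num : (0 : ℝ) ≤ 32)
  have b4 := mul_le_mul_of_nonneg_left (sum_weight_kernel_le a N X hT hTT' hB) (by norm_num : (0 : ℝ) ≤ 32)
  simp only [Finset.mul_sum] at b0 b1 b2 b3 b4
  refine (Finset.sum_le_sum fun h hh => Finset.sum_le_sum fun k hk => Finset.sum_le_sum fun μ hμ =>
    Finset.sum_le_sum fun ν hν => hpt h hh k hk μ hμ ν hν).trans ?_
  simp only [Finset.sum_add_distrib]
  linarith

end Literature.NumberTheory.LFunctions.BCH
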